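import Mathlib
import Summits.ResolutionOfSingularities.ResolutionOfSingularities.Theorems.WeightedInvariantLocalWeightedDropNCResSurfGraphIdeal
import Summits.ResolutionOfSingularities.ResolutionOfSingularities.Theorems.WeightedInvariantLocalWeightedDropNCBlocks
import Summits.ResolutionOfSingularities.ResolutionOfSingularities.Theorems.WeightedInvariantLocalWeightedDropTOT2NearDir

/-!
# `WeightedInvariant.LocalWeightedDrop`: NC-resolution settings for the TOT₂ line — GRAPH SURFACES, part 3: the TANGENT PLANE of a graph surface
# (the two base directions through the linear part of the shear) and «at apex dimension ≤ 2 every invariance vector is a combination of them»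

Crux item stmt-ResolutionOfSingularities-8899 `LocalWeightedDrop` (route `ResolutionOfSingularities/WeightedInvariant`), ENGINE skeleton v32, residuals
`stub_spaceNCRankDrop` / `stub_wildWideApexFourStartsWon` (res-L1-w43-strat-1's line `directrix-cut` v3.1, piece PL = `ApexPlaneExit`, SURFACE sub-case;
design memo `L/res-L1-w43-stub-4/g5/S-E2-SURF.md`).  [OURS · L1 W4.3 · chain w43 · seat res-L1-w43-stub-4 gen 5; two bookkeeping definitions
(`tangentL`, `tangentR`) + their algebra; surface twin of the `tangent` block of res-L1-w43-stub-1's `…NCResCurveGraphDefs/Ideal`; the count game is the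
programme's own; nothing here is a statement of any manuscript; AI-produced, gate-checked, weaker than expert review.]

* `onPlane_eq_rename` — `ψ(x_a, x_b)` is the renaming of `ψ` along the base embedding `0 ↦ a, 1 ↦ b`; hence its LINEAR coefficients:
  `coeff_single_onPlane_left/right/of_ne`;
* `tangentL a b ψ`, `tangentR a b ψ` — the two TANGENT DIRECTIONS of the graph surface `S = {x_j = ψ_j(x_a, x_b)}`: `(1, 0, ∂₁ψ_j(0))` and
  `(0, 1, ∂₂ψ_j(0))`; they are the images of `e_a`, `e_b` under the linear part of the shear (`linMat_shear_mulVec_single_left/right`), and they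
  are linearly independent (`tangent_independent`);
* **`tangentL_inv`, `tangentR_inv`, `combo_tangent_inv`** — for `g` with `Φ_S^* g ∈ (x_j : j ∉ {a,b})^c`, `c = ord g`, the tangent plane of `S`
  consists of invariance vectors of the degree-`c` form of `g` (`T_x S ⊆ Dir`; part 2's `base_inv`);
* **`eq_combo_tangent_of_inv`** — AT APEX DIMENSION ≤ 2 (every three invariance vectors dependent) the converse: every invariance vector `u` is
  `u_a • tangentL + u_b • tangentR` (`Dir = T_x S`) — so a NEAR exceptional point of the point move (an invariance vector by res-L1-w43-stub-3's
  (N1)) lies in the tangent plane of `S`: the successor lies on the strict transform of `S` (sequel, the point-move step).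
-/

set_option linter.dupNamespace false -- mandated namespace of this single-conjunct summit

noncomputable section

namespace Summit.ResolutionOfSingularities.ResolutionOfSingularities.Theorems

namespace TameFourTupleDrop

namespace GraphSurf

open MvPowerSeries Literature.AlgebraicGeometry.Resolution

variable {k : Type} [Field k] {m : ℕ}

/-! ## `onPlane` as a renaming; linear coefficients -/

/-- The base embedding `0 ↦ a`, `1 ↦ b` of `Fin 2` into the letters (`a ≠ b`). -/
def baseEmb (a b : Fin (m + 1)) (hab : a ≠ b) : Fin 2 ↪ Fin (m + 1) :=
  ⟨![a, b], fun i j h => by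
    fin_cases i <;> fin_cases j
    · rfl
    · exact absurd h hab
    · exact absurd h.symm hab
    · rfl⟩

/-- Values of the base embedding. -/
theorem baseEmb_zero (a b : Fin (m + 1)) (hab : a ≠ b) : baseEmb a b hab 0 = a := rfl

/-- Values of the base embedding. -/
theorem baseEmb_one (a b : Fin (m + 1)) (hab : a ≠ b) : baseEmb a b hab 1 = b := rfl

/-- The range of the base embedding is `{a, b}`. -/
theorem mem_range_baseEmb_iff {a b : Fin (m + 1)} (hab : a ≠ b) {j : Fin (m + 1)} :
    j ∈ Set.range (baseEmb a b hab) ↔ (j = a ∨ j = b) := by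
  constructor
  · rintro ⟨t, rfl⟩
    fin_cases t
    · exact Or.inl rfl
    · exact Or.inr rfl
  · rintro (rfl | rfl)
    · exact ⟨0, rfl⟩
    · exact ⟨1, rfl⟩

/-- **`ψ(x_a, x_b)` IS THE RENAMING OF `ψ` ALONG THE BASE EMBEDDING.** -/
theorem onPlane_eq_rename {a b : Fin (m + 1)} (hab : a ≠ b) (ψ : MvPowerSeries (Fin 2) k) :
    onPlane a b ψ = rename (baseEmb a b hab) ψ := by
  rw [rename_eq_subst, onPlane]
  congr 1
  funext t
  fin_cases t <;> rfl

/-- The linear coefficient of `ψ(x_a, x_b)` at `x_a` is `∂₁ψ(0)`. -/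
theorem coeff_single_onPlane_left {a b : Fin (m + 1)} (hab : a ≠ b) (ψ : MvPowerSeries (Fin 2) k) :
    coeff (Finsupp.single a 1) (onPlane a b ψ) = coeff (Finsupp.single 0 1) ψ := by
  rw [onPlane_eq_rename hab]
  exact NCTransport.coeff_single_rename_self (baseEmb a b hab) ψ 0

/-- The linear coefficient of `ψ(x_a, x_b)` at `x_b` is `∂₂ψ(0)`. -/
theorem coeff_single_onPlane_right {a b : Fin (m + 1)} (hab : a ≠ b) (ψ : MvPowerSeries (Fin 2) k) :
    coeff (Finsupp.single b 1) (onPlane a b ψ) = coeff (Finsupp.single 1 1) ψ := by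
  rw [onPlane_eq_rename hab]
  exact NCTransport.coeff_single_rename_self (baseEmb a b hab) ψ 1

/-- The linear coefficients of `ψ(x_a, x_b)` off the base vanish. -/
theorem coeff_single_onPlane_of_ne {a b j : Fin (m + 1)} (hab : a ≠ b) (hj : ¬ (j = a ∨ j = b)) (ψ : MvPowerSeries (Fin 2) k) :
    coeff (Finsupp.single j 1) (onPlane a b ψ) = 0 := by
  rw [onPlane_eq_rename hab]
  exact NCTransport.coeff_single_rename_of_not_mem _ _ (fun h => hj ((mem_range_baseEmb_iff hab).mp h))

/-! ## The tangent plane -/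

/-- The FIRST TANGENT DIRECTION of the graph surface: `1` at `a`, `0` at `b`, `∂₁ψ_j(0)` at `j ∉ {a,b}`. [OURS] -/
def tangentL (a b : Fin (m + 1)) (ψ : Fin (m + 1) → MvPowerSeries (Fin 2) k) : Fin (m + 1) → k :=
  fun j => if j = a then 1 else if j = b then 0 else coeff (Finsupp.single 0 1) (ψ j)

/-- The SECOND TANGENT DIRECTION of the graph surface: `0` at `a`, `1` at `b`, `∂₂ψ_j(0)` at `j ∉ {a,b}`. [OURS] -/
def tangentR (a b : Fin (m + 1)) (ψ : Fin (m + 1) → MvPowerSeries (Fin 2) k) : Fin (m + 1) → k :=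
  fun j => if j = a then 0 else if j = b then 1 else coeff (Finsupp.single 1 1) (ψ j)

section Tangent

variable {a b : Fin (m + 1)} (ψ : Fin (m + 1) → MvPowerSeries (Fin 2) k)

/-- Values of the first tangent direction. -/
theorem tangentL_left : tangentL a b ψ a = 1 := by simp [tangentL]

/-- Values of the first tangent direction. -/
theorem tangentL_right (hab : a ≠ b) : tangentL a b ψ b = 0 := by simp [tangentL, hab.symm]

/-- Values of the first tangent direction. -/
theorem tangentL_of_ne {j : Fin (m + 1)} (hj : ¬ (j = a ∨ j = b)) : tangentL a b ψ j = coeff (Finsupp.single 0 1) (ψ j) := by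
  simp [tangentL, not_or.mp hj]

/-- Values of the second tangent direction. -/
theorem tangentR_left : tangentR a b ψ a = 0 := by simp [tangentR]

/-- Values of the second tangent direction. -/
theorem tangentR_right (hab : a ≠ b) : tangentR a b ψ b = 1 := by simp [tangentR, hab.symm]

/-- Values of the second tangent direction. -/
theorem tangentR_of_ne {j : Fin (m + 1)} (hj : ¬ (j = a ∨ j = b)) : tangentR a b ψ j = coeff (Finsupp.single 1 1) (ψ j) := by
  simp [tangentR, not_or.mp hj]

variable (hab : a ≠ b)
include hab

/-- THE LINEAR PART OF THE SHEAR: the `a`-th column is the first tangent direction. -/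
theorem coeff_single_shear_left (j : Fin (m + 1)) : coeff (Finsupp.single a 1) (shear a b ψ j) = tangentL a b ψ j := by
  by_cases h : j = a ∨ j = b
  · rw [shear_of_base h]
    rcases h with rfl | rfl
    · rw [tangentL_left, coeff_X, if_pos rfl]
    · rw [tangentL_right ψ hab, coeff_X, if_neg (fun h' => hab (Finsupp.single_left_injective one_ne_zero h'))]
  · rw [shear_of_ne h, tangentL_of_ne ψ h, map_add, coeff_X,
      if_neg (fun h' => h (Or.inl (Finsupp.single_left_injective one_ne_zero h').symm)), zero_add, coeff_single_onPlane_left hab]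

/-- THE LINEAR PART OF THE SHEAR: the `b`-th column is the second tangent direction. -/
theorem coeff_single_shear_right (j : Fin (m + 1)) : coeff (Finsupp.single b 1) (shear a b ψ j) = tangentR a b ψ j := by
  by_cases h : j = a ∨ j = b
  · rw [shear_of_base h]
    rcases h with rfl | rfl
    · rw [tangentR_left, coeff_X, if_neg (fun h' => hab (Finsupp.single_left_injective one_ne_zero h').symm)]
    · rw [tangentR_right ψ hab, coeff_X, if_pos rfl]
  · rw [shear_of_ne h, tangentR_of_ne ψ h, map_add, coeff_X,
      if_neg (fun h' => h (Or.inr (Finsupp.single_left_injective one_ne_zero h').symm)), zero_add, coeff_single_onPlane_right hab]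

/-- The first tangent direction is the image of `t • e_a` under the linear part of the shear. -/
theorem linMat_shear_mulVec_single_left (t : k) :
    (Matrix.of fun i l : Fin (m + 1) => coeff (Finsupp.single l 1) (shear a b ψ i)).mulVec (Pi.single a t) = t • tangentL a b ψ := by
  have h1 : (Matrix.of fun i l : Fin (m + 1) => coeff (Finsupp.single l 1) (shear a b ψ i)).mulVec (Pi.single a 1) = tangentL a b ψ := by
    funext i
    rw [Matrix.mulVec_single_one]
    exact coeff_single_shear_left ψ hab i
  rw [show (Pi.single a t : Fin (m + 1) → k) = t • Pi.single a 1 by rw [← Pi.single_smul', smul_eq_mul, mul_one],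
    Matrix.mulVec_smul, h1]

/-- The second tangent direction is the image of `t • e_b` under the linear part of the shear. -/
theorem linMat_shear_mulVec_single_right (t : k) :
    (Matrix.of fun i l : Fin (m + 1) => coeff (Finsupp.single l 1) (shear a b ψ i)).mulVec (Pi.single b t) = t • tangentR a b ψ := by
  have h1 : (Matrix.of fun i l : Fin (m + 1) => coeff (Finsupp.single l 1) (shear a b ψ i)).mulVec (Pi.single b 1) = tangentR a b ψ := by
    funext i
    rw [Matrix.mulVec_single_one]
    exact coeff_single_shear_right ψ hab i
  rw [show (Pi.single b t : Fin (m + 1) → k) = t • Pi.single b 1 by rw [← Pi.single_smul', smul_eq_mul, mul_one],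
    Matrix.mulVec_smul, h1]

/-- THE TWO TANGENT DIRECTIONS ARE LINEARLY INDEPENDENT (read at the base slots). -/
theorem tangent_independent (α β : k) (h : α • tangentL a b ψ + β • tangentR a b ψ = 0) : α = 0 ∧ β = 0 := by
  have ha := congr_fun h a
  have hb := congr_fun h b
  simp only [Pi.add_apply, Pi.smul_apply, smul_eq_mul, tangentL_left ψ, tangentR_left ψ, tangentL_right ψ hab, tangentR_right ψ hab,
    mul_one, mul_zero, add_zero, zero_add, Pi.zero_apply] at ha hb
  exact ⟨ha, hb⟩

/-! ## The tangent plane lies in the directrix; at apex dimension `≤ 2` it is the directrix -/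

variable {ψ}

/-- **THE FIRST TANGENT DIRECTION IS AN INVARIANCE VECTOR** of the degree-`c` form of `g`, when the graph shear's pull-back `Φ_S^* g` lies in
`(x_j : j ∉ {a,b})^c` with `c = ord g` (the surface is permissible for `g` at order `c`). -/
theorem tangentL_smul_inv (hψ : ∀ j, ¬ (j = a ∨ j = b) → constantCoeff (ψ j) = 0) {g : MvPowerSeries (Fin (m + 1)) k} {c : ℕ}
    (hgc : g.order = c) (hperm : InOffPlaneIdeal a b c (subst (shear a b ψ) g)) (t : k) (v : Fin (m + 1) → k) :
    CobordantChart.initEval (fun _ : Fin (m + 1) => 1) (v + t • tangentL a b ψ) c g = CobordantChart.initEval (fun _ : Fin (m + 1) => 1) v c g := by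
  rw [← linMat_shear_mulVec_single_left ψ hab t]
  exact base_inv hab hψ hgc hperm (Or.inl rfl) t v

/-- **THE SECOND TANGENT DIRECTION IS AN INVARIANCE VECTOR.** -/
theorem tangentR_smul_inv (hψ : ∀ j, ¬ (j = a ∨ j = b) → constantCoeff (ψ j) = 0) {g : MvPowerSeries (Fin (m + 1)) k} {c : ℕ}
    (hgc : g.order = c) (hperm : InOffPlaneIdeal a b c (subst (shear a b ψ) g)) (t : k) (v : Fin (m + 1) → k) :
    CobordantChart.initEval (fun _ : Fin (m + 1) => 1) (v + t • tangentR a b ψ) c g = CobordantChart.initEval (fun _ : Fin (m + 1) => 1) v c g := by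
  rw [← linMat_shear_mulVec_single_right ψ hab t]
  exact base_inv hab hψ hgc hperm (Or.inr rfl) t v

/-- **THE TANGENT PLANE LIES IN THE DIRECTRIX**: every combination of the two tangent directions is an invariance vector. -/
theorem combo_tangent_inv (hψ : ∀ j, ¬ (j = a ∨ j = b) → constantCoeff (ψ j) = 0) {g : MvPowerSeries (Fin (m + 1)) k} {c : ℕ}
    (hgc : g.order = c) (hperm : InOffPlaneIdeal a b c (subst (shear a b ψ) g)) (α β : k) (v : Fin (m + 1) → k) :
    CobordantChart.initEval (fun _ : Fin (m + 1) => 1) (v + (α • tangentL a b ψ + β • tangentR a b ψ)) c g =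
      CobordantChart.initEval (fun _ : Fin (m + 1) => 1) v c g := by
  rw [← add_assoc, tangentR_smul_inv hab hψ hgc hperm β, tangentL_smul_inv hab hψ hgc hperm α]

/-- **AT APEX DIMENSION ≤ 2, EVERY INVARIANCE VECTOR LIES IN THE TANGENT PLANE**: if every three invariance vectors of the degree-`c` form of `g` are
dependent, an invariance vector `u` equals `u_a • tangentL + u_b • tangentR` (`Dir = T_x S`).  Consequence (sequel): a NEAR exceptional point of the
point move — an invariance vector by (N1) — is a tangent direction of `S`, and the successor lies on the strict transform of `S`. -/
theorem eq_combo_tangent_of_inv (hψ : ∀ j, ¬ (j = a ∨ j = b) → constantCoeff (ψ j) = 0) {g : MvPowerSeries (Fin (m + 1)) k} {c : ℕ}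
    (hgc : g.order = c) (hperm : InOffPlaneIdeal a b c (subst (shear a b ψ) g))
    (htwo : ∀ u₁ u₂ u₃ : Fin (m + 1) → k,
      (∀ v, CobordantChart.initEval (fun _ : Fin (m + 1) => 1) (v + u₁) c g = CobordantChart.initEval (fun _ : Fin (m + 1) => 1) v c g) →
      (∀ v, CobordantChart.initEval (fun _ : Fin (m + 1) => 1) (v + u₂) c g = CobordantChart.initEval (fun _ : Fin (m + 1) => 1) v c g) →
      (∀ v, CobordantChart.initEval (fun _ : Fin (m + 1) => 1) (v + u₃) c g = CobordantChart.initEval (fun _ : Fin (m + 1) => 1) v c g) →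
      ∃ α β γ : k, (α ≠ 0 ∨ β ≠ 0 ∨ γ ≠ 0) ∧ α • u₁ + β • u₂ + γ • u₃ = 0)
    {u : Fin (m + 1) → k}
    (hu : ∀ v, CobordantChart.initEval (fun _ : Fin (m + 1) => 1) (v + u) c g = CobordantChart.initEval (fun _ : Fin (m + 1) => 1) v c g) :
    u = u a • tangentL a b ψ + u b • tangentR a b ψ := by
  have h1 : ∀ v, CobordantChart.initEval (fun _ : Fin (m + 1) => 1) (v + tangentL a b ψ) c g =
      CobordantChart.initEval (fun _ : Fin (m + 1) => 1) v c g := fun v => by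
    have h := tangentL_smul_inv hab hψ hgc hperm 1 v
    rwa [one_smul] at h
  have h2 : ∀ v, CobordantChart.initEval (fun _ : Fin (m + 1) => 1) (v + tangentR a b ψ) c g =
      CobordantChart.initEval (fun _ : Fin (m + 1) => 1) v c g := fun v => by
    have h := tangentR_smul_inv hab hψ hgc hperm 1 v
    rwa [one_smul] at h
  obtain ⟨α, β, γ, hne, hrel⟩ := htwo (tangentL a b ψ) (tangentR a b ψ) u h1 h2 hu
  have hγ : γ ≠ 0 := by
    intro hγ
    rw [hγ, zero_smul, add_zero] at hrel
    obtain ⟨hα, hβ⟩ := tangent_independent ψ hab α β hrel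
    rcases hne with h | h | h
    · exact h hα
    · exact h hβ
    · exact h hγ
  -- solve for `u`
  have hu' : u = (-(α / γ)) • tangentL a b ψ + (-(β / γ)) • tangentR a b ψ := by
    have h3 : γ • u = -(α • tangentL a b ψ + β • tangentR a b ψ) := by
      rw [eq_neg_iff_add_eq_zero, ← hrel]; abel
    calc u = γ⁻¹ • (γ • u) := by rw [smul_smul, inv_mul_cancel₀ hγ, one_smul]
      _ = (-(α / γ)) • tangentL a b ψ + (-(β / γ)) • tangentR a b ψ := by
        rw [h3, smul_neg, smul_add, smul_smul, smul_smul, neg_add, ← neg_smul, ← neg_smul]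
        congr 2 <;> rw [div_eq_inv_mul]
  have hua : u a = -(α / γ) := by
    have h := congrFun hu' a
    simp only [Pi.add_apply, Pi.smul_apply, smul_eq_mul, tangentL_left, tangentR_left, mul_one, mul_zero, add_zero] at h
    exact h
  have hub : u b = -(β / γ) := by
    have h := congrFun hu' b
    simp only [Pi.add_apply, Pi.smul_apply, smul_eq_mul, tangentL_right _ hab, tangentR_right _ hab, mul_one, mul_zero, zero_add] at h
    exact h
  rw [hua, hub]
  exact hu'

end Tangent

end GraphSurf

end TameFourTupleDrop

end Summit.ResolutionOfSingularities.ResolutionOfSingularities.Theorems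

end
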